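import Literature.NumberTheory.Sieve.QuadraticRootsTothWeylSum
import Literature.NumberTheory.Sieve.QuadraticRootsLevelOrbitalWeight
import Literature.NumberTheory.Sieve.QuadraticRootsPrimeModuliDFIStrip
import Mathlib.MeasureTheory.Integral.IntegralEqImproper
import HarnessLib

/-!
# Unfolding a class of closed geodesics into a cycle integral of a Poincaré series (`Δ > 0`)

Topic `Literature/NumberTheory/Sieve`, continuation of `QuadraticRootsLevelDeck.lean`: the bridge
between the arithmetic side (sums over the `T`-reduced level forms of a `Γ₀(q)`-class, into which
`QuadraticRootsLevelForms/…/Classes` turn the Weyl sums `∑_{n ≡ 0 (d)} G(n) ρ_h(n)`) and the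
analytic side (Poincaré series on `Γ₀(q)∖ℍ`) of Á. Tóth's positive-discriminant theorem — the
analogue of Duke–Friedlander–Iwaniec's identity (14), with the Heegner point replaced by the closed
geodesic.  For a kernel `φ` on `ℍ`, invariant under `z ↦ z + 1` and vanishing below some height
`Y > 0`, the **Poincaré series** is `P_φ(z) = ∑_{σ ∈ Γ∞∖Γ₀(q)} φ(σz)` (a finite sum for each `z`,
`RootForms.poincareFn`, indexed by the coprime bottom rows `DFI1995.CuspPair q`), and the
**geodesic weight** of a form `Q` with `A ≠ 0`, `Δ > 0` is `𝒲_φ(Q) = ∫_{S_Q} φ ds`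
(`RootForms.geodWeight`, the integral `∫_{t>0} φ(P(t)) dt/t` along the parametrised semicircle of
`Q`, resp. of `−Q` when `A < 0`).  The main theorem **`RootForms.cycleIntegral_poincareFn_eq_tsum`**:
for `R = [A, B, C]` with `A > 0`, non-square `Δ > 0`, and the deck generator `g₁` of
`stab_q(R) = {±g₁^k}` (`…LevelDeck.exists_deck_generator`, `0 < κ₁ = κ(g₁) < 1`),

  `∫_{κ₁}^{1} P_φ(P_R(t)) dt/t = ∑'_{Q} 𝒲_φ(Q)`,

the sum over the `T`-reduced forms `Q` of the `Γ₀(q)`-orbit of `R` (both signs of `Q.a`; finitely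
many non-zero terms).  The left side is the integral of `P_φ` over the closed geodesic of `R` on
`Γ₀(q)∖ℍ` (one period of the deck transformation).  Ingredients, all proved here:

* local finiteness of `Γ∞∖Γ₀(q)` above height `Y` over a compact box (`finite_cuspPairs_above`);
* the **adapted transversal** `(k, Q) ↦ (g₁^k ξ_Q)⁻¹` of `Γ∞∖Γ₀(q)` (`ξ_Q ∈ Γ₀(q)` with
  `R·ξ_Q = Q`), a bijection `ℤ × TRedOrbit R q ≃ CuspPair q` (`adaptedEquiv`), whence
  `P_φ(z) = ∑'_{(k, Q)} φ(ξ_Q⁻¹ g₁^{-k} z)` (`poincareFn_eq_tsum_adapted`);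
* along the axis `g₁^{-k}` is the dilation `t ↦ κ₁^{-k} t` (`…LevelDeck`), so the `k`-sum
  telescopes the period `[κ₁, 1]` into `(0, ∞)`, and `ξ_Q⁻¹ P_R(s) = P_Q(κ s)` (resp.
  `P_{−Q}(κ/s)`) turns `∫_0^∞ φ(ξ_Q⁻¹ P_R(s)) ds/s` into `𝒲_φ(Q)` (Haar measure `ds/s`).

## References

* Á. Tóth, *Roots of quadratic congruences*, IMRN 2000, no. 14, 719–739 (sums of Weyl sums over
  closed geodesics unfolded against Poincaré series on `Γ₀(q)`; cite-only in the store, cf.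
  [cite: Ngo2024, §1 (1.3) and the paragraph before it]). [cite: Toth2000, main theorem]
* W. Duke, J. B. Friedlander, H. Iwaniec, Ann. of Math. (2) 141 (1995), (14) p. 428 (the model
  identity for `Δ < 0`). [cite: DukeFriedlanderIwaniec1995, (14) p. 428]
* H. Iwaniec, *Spectral Methods of Automorphic Forms*, GSM 53 (2002), §2.3 (the cosets
  `Γ∞∖Γ₀(q)` by bottom rows), §3.2 (unfolding). [cite: Iwaniec2002, §2.3, §3.2]
-/

noncomputable section

namespace Literature.NumberTheory.Sieve

open scoped MatrixGroups UpperHalfPlane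
open Literature.NumberTheory.QuadraticFields.Quadratic (BinQF)
open UpperHalfPlane MeasureTheory
open ModularGroup (T)

namespace RootForms

variable {q : ℕ} {R : BinQF}

/-! ### Poincaré series over `Γ∞∖Γ₀(q)` -/

/-- The **Poincaré series** `P_φ(z) = ∑_{σ ∈ Γ∞∖Γ₀(q)} φ(σ • z)`, the cosets indexed by their
bottom rows `DFI1995.CuspPair q` (for `φ` invariant under `z ↦ z + 1`; a finite sum for each `z`
when `φ` vanishes below some height, and `0` by convention when not summable).
[cite: DukeFriedlanderIwaniec1995, (14) p. 428] -/
def poincareFn (q : ℕ) (φ : ℍ → ℂ) (z : ℍ) : ℂ := ∑' p : DFI1995.CuspPair q, φ (p.toSL • z)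

/-- `T^j`-invariance from `T`-invariance. [folklore] -/
theorem apply_T_zpow_smul {φ : ℍ → ℂ} (hT : ∀ z : ℍ, φ (T • z) = φ z) (j : ℤ) (z : ℍ) :
    φ (T ^ j • z) = φ z := by
  have hnat : ∀ (n : ℕ) (w : ℍ), φ (T ^ (n : ℤ) • w) = φ w := by
    intro n
    induction n with
    | zero => intro w; simp
    | succ n ih => intro w; rw [Nat.cast_succ, zpow_add_one, mul_smul, ih, hT]
  obtain ⟨n, rfl | rfl⟩ := Int.eq_nat_or_neg j
  · exact hnat n z
  · have := hnat n (T ^ (-(n : ℤ)) • z)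
    rw [← mul_smul, ← zpow_add, add_neg_cancel, zpow_zero, one_smul] at this
    exact this.symm

/-! ### Local finiteness of `Γ∞∖Γ₀(q)` above a height -/

/-- `Im(σ_p • z) = Im z / |cz + d|²`. [cite: Iwaniec2002, §2.3] -/
theorem im_toSL_smul (p : DFI1995.CuspPair q) (z : ℍ) :
    (p.toSL • z).im = z.im / Complex.normSq ((p.c : ℂ) * z + p.d) := by
  rw [ModularGroup.im_smul_eq_div_normSq, ModularGroup.denom_apply]
  simp [DFI1995.CuspPair.toSL_apply_10, DFI1995.CuspPair.toSL_apply_11]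

/-- **Local finiteness**: only finitely many cosets `σ ∈ Γ∞∖Γ₀(q)` lift some point of the box
`|Re z| ≤ X₀`, `y₀ ≤ Im z ≤ y₁` (`y₀ > 0`) to height `≥ Y > 0` — the bottom rows satisfy
`c² y₀² ≤ y₁/Y` and `(c Re z + d)² ≤ y₁/Y`. [cite: Iwaniec2002, §2.3] -/
theorem finite_cuspPairs_above (q : ℕ) {X₀ y₀ y₁ Y : ℝ} (hy₀ : 0 < y₀) (hY : 0 < Y) :
    {p : DFI1995.CuspPair q | ∃ z : ℍ, |z.re| ≤ X₀ ∧ y₀ ≤ z.im ∧ z.im ≤ y₁ ∧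
      Y ≤ (p.toSL • z).im}.Finite := by
  set B : ℝ := y₁ / Y with hB
  set Cb : ℤ := ⌈Real.sqrt B / y₀⌉ with hCb
  set Db : ℤ := ⌈Real.sqrt B / y₀ * |X₀| + Real.sqrt B⌉ with hDb
  have hbox : (Set.Icc (-Cb) Cb ×ˢ Set.Icc (-Db) Db : Set (ℤ × ℤ)).Finite :=
    (Set.finite_Icc _ _).prod (Set.finite_Icc _ _)
  refine (hbox.preimage (f := fun p : DFI1995.CuspPair q => (p.c, p.d)) ?_).subset ?_
  · intro p _ p' _ h
    simp only [Prod.mk.injEq] at h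
    exact DFI1995.CuspPair.ext_iff'.2 h
  rintro p ⟨z, hre, hy0, hy1, hYle⟩
  rw [im_toSL_smul] at hYle
  have hz : 0 < z.im := z.im_pos
  have hN : 0 < Complex.normSq ((p.c : ℂ) * z + p.d) := by
    rw [Complex.normSq_pos]
    have := denomZ_ne_zero p.toSL z
    simpa [DFI1995.CuspPair.toSL_apply_10, DFI1995.CuspPair.toSL_apply_11] using this
  -- `normSq ≤ B`
  have hNB : Complex.normSq ((p.c : ℂ) * z + p.d) ≤ B := by
    rw [le_div_iff₀ hN] at hYle
    rw [hB, le_div_iff₀ hY]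
    calc Complex.normSq ((p.c : ℂ) * z + p.d) * Y = Y * Complex.normSq ((p.c : ℂ) * z + p.d) := by
          ring
      _ ≤ z.im := hYle
      _ ≤ y₁ := hy1
  have hB0 : 0 ≤ B := hN.le.trans hNB
  have hNeq : Complex.normSq ((p.c : ℂ) * z + p.d) = ((p.c : ℝ) * z.re + p.d) ^ 2 + ((p.c : ℝ) * z.im) ^ 2 := by
    rw [Complex.normSq_apply]
    simp only [Complex.add_re, Complex.mul_re, Complex.intCast_re, UpperHalfPlane.coe_re,
      Complex.intCast_im, UpperHalfPlane.coe_im, zero_mul, sub_zero, add_zero, Complex.add_im,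
      Complex.mul_im]
    ring
  have hsq1 : ((p.c : ℝ) * z.im) ^ 2 ≤ B := by nlinarith [sq_nonneg ((p.c : ℝ) * z.re + p.d)]
  have hsq2 : ((p.c : ℝ) * z.re + p.d) ^ 2 ≤ B := by nlinarith [sq_nonneg ((p.c : ℝ) * z.im)]
  have hsB := Real.sqrt_nonneg B
  -- `|c| ≤ √B / y₀`
  have hc : |(p.c : ℝ)| ≤ Real.sqrt B / y₀ := by
    rw [le_div_iff₀ hy₀]
    have h1 : |(p.c : ℝ) * z.im| ≤ Real.sqrt B := Real.abs_le_sqrt hsq1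
    rw [abs_mul, abs_of_pos hz] at h1
    calc |(p.c : ℝ)| * y₀ ≤ |(p.c : ℝ)| * z.im := mul_le_mul_of_nonneg_left hy0 (abs_nonneg _)
      _ ≤ Real.sqrt B := h1
  -- `|d| ≤ |c| |X₀| + √B`
  have hd : |(p.d : ℝ)| ≤ Real.sqrt B / y₀ * |X₀| + Real.sqrt B := by
    have h1 : |(p.c : ℝ) * z.re + p.d| ≤ Real.sqrt B := Real.abs_le_sqrt hsq2
    have h2 : |(p.d : ℝ)| ≤ |(p.c : ℝ) * z.re| + Real.sqrt B := by
      have := abs_sub_abs_le_abs_sub ((p.c : ℝ) * z.re + p.d) ((p.c : ℝ) * z.re)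
      rw [add_sub_cancel_left] at this
      have h3 : |(p.d : ℝ)| ≤ |(p.c : ℝ) * z.re + p.d| + |(p.c : ℝ) * z.re| := by
        have := abs_add_le ((p.c : ℝ) * z.re + p.d) (-((p.c : ℝ) * z.re))
        rw [abs_neg, add_neg_cancel_comm] at this
        exact this
      linarith
    have h4 : |(p.c : ℝ) * z.re| ≤ Real.sqrt B / y₀ * |X₀| := by
      rw [abs_mul]
      have hzre : |z.re| ≤ |X₀| := hre.trans (le_abs_self _)
      exact mul_le_mul hc hzre (abs_nonneg _) (by positivity)
    linarith
  simp only [Set.mem_preimage, Set.mem_prod, Set.mem_Icc]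
  have hcZ : -Cb ≤ p.c ∧ p.c ≤ Cb := by
    have h1 : ((p.c : ℤ) : ℝ) ≤ Cb := (le_abs_self _).trans (hc.trans (Int.le_ceil _))
    have h2 : (-(Cb : ℝ)) ≤ ((p.c : ℤ) : ℝ) := by
      have := neg_abs_le (p.c : ℝ)
      have h3 : -(Cb : ℝ) ≤ -|(p.c : ℝ)| := neg_le_neg (hc.trans (Int.le_ceil _))
      exact h3.trans this
    constructor
    · exact_mod_cast h2
    · exact_mod_cast h1
  have hdZ : -Db ≤ p.d ∧ p.d ≤ Db := by
    have h1 : ((p.d : ℤ) : ℝ) ≤ Db := (le_abs_self _).trans (hd.trans (Int.le_ceil _))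
    have h2 : (-(Db : ℝ)) ≤ ((p.d : ℤ) : ℝ) := by
      have := neg_abs_le (p.d : ℝ)
      have h3 : -(Db : ℝ) ≤ -|(p.d : ℝ)| := neg_le_neg (hd.trans (Int.le_ceil _))
      exact h3.trans this
    constructor
    · exact_mod_cast h2
    · exact_mod_cast h1
  exact ⟨hcZ, hdZ⟩

/-! ### The coset of an element of `Γ₀(q)` -/

/-- The bottom-row coset `Γ∞γ ∈ Γ∞∖Γ₀(q)` of `γ ∈ Γ₀(q)`, as a `CuspPair`. [cite: Iwaniec2002, §2.3] -/
def cuspOf (γ : SL(2, ℤ)) (hγ : γ ∈ CongruenceSubgroup.Gamma0 q) : DFI1995.CuspPair q :=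
  ((DFI1995.decompEquiv q).symm ⟨γ, hγ⟩).2.2

/-- `ε g = ±g`: the sign as a central factor. [folklore] -/
theorem sgn_eq (ε : Bool) (g : SL(2, ℤ)) : DFI1995.sgn ε g = g ∨ DFI1995.sgn ε g = -g := by
  cases ε <;> simp

/-- `γ = ±T^m σ_{Γ∞γ}`. [cite: Iwaniec2002, §2.3] -/
theorem exists_eq_T_zpow_mul_cuspOf {γ : SL(2, ℤ)} (hγ : γ ∈ CongruenceSubgroup.Gamma0 q) :
    ∃ m : ℤ, γ = T ^ m * (cuspOf γ hγ).toSL ∨ γ = -(T ^ m * (cuspOf γ hγ).toSL) := by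
  set x := (DFI1995.decompEquiv q).symm ⟨γ, hγ⟩ with hx
  have h1 : ((DFI1995.decompEquiv q x : CongruenceSubgroup.Gamma0 q) : SL(2, ℤ)) = γ := by
    rw [hx, Equiv.apply_symm_apply]
  rw [DFI1995.decompEquiv_apply, DFI1995.decomp] at h1
  refine ⟨x.2.1, ?_⟩
  have hc : cuspOf γ hγ = x.2.2 := rfl
  rw [hc]
  rcases sgn_eq x.1 (T ^ x.2.1 * x.2.2.toSL) with h | h
  · left; rw [← h]; exact h1.symm
  · right; rw [← h]; exact h1.symm

/-- Uniqueness: if `γ = ±T^m σ_p` then `Γ∞γ = p`. [cite: Iwaniec2002, §2.3] -/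
theorem cuspOf_eq_of_eq {γ : SL(2, ℤ)} (hγ : γ ∈ CongruenceSubgroup.Gamma0 q) (ε : Bool) (m : ℤ)
    (p : DFI1995.CuspPair q) (h : γ = DFI1995.sgn ε (T ^ m * p.toSL)) : cuspOf γ hγ = p := by
  have h1 : DFI1995.decompEquiv q (ε, m, p) = ⟨γ, hγ⟩ := by
    apply Subtype.ext
    subst h
    rfl
  rw [cuspOf, ← h1, Equiv.symm_apply_apply]

/-- **A `T`-invariant kernel sees only the coset**: `φ(σ_{Γ∞γ} • z) = φ(γ • z)`.
[cite: Iwaniec2002, §2.3] -/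
theorem apply_cuspOf_smul {φ : ℍ → ℂ} (hT : ∀ z : ℍ, φ (T • z) = φ z) {γ : SL(2, ℤ)}
    (hγ : γ ∈ CongruenceSubgroup.Gamma0 q) (z : ℍ) :
    φ ((cuspOf γ hγ).toSL • z) = φ (γ • z) := by
  obtain ⟨m, h | h⟩ := exists_eq_T_zpow_mul_cuspOf hγ
  · conv_rhs => rw [h, mul_smul, apply_T_zpow_smul hT]
  · conv_rhs => rw [h, ModularGroup.SL_neg_smul, mul_smul, apply_T_zpow_smul hT]

/-- The coset determines the height: `Im(σ_{Γ∞γ} • z) = Im(γ • z)`. [folklore] -/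
theorem im_cuspOf_smul {γ : SL(2, ℤ)} (hγ : γ ∈ CongruenceSubgroup.Gamma0 q) (z : ℍ) :
    ((cuspOf γ hγ).toSL • z).im = (γ • z).im := by
  obtain ⟨m, h | h⟩ := exists_eq_T_zpow_mul_cuspOf hγ
  · conv_rhs => rw [h, mul_smul, ModularGroup.im_T_zpow_smul]
  · conv_rhs => rw [h, ModularGroup.SL_neg_smul, mul_smul, ModularGroup.im_T_zpow_smul]

/-! ### The `T`-reduced forms of the `Γ₀(q)`-orbit and the adapted transversal -/

-- `TRedOrbit R q`, `TRedOrbit.lift/lift_mem/smul_lift/isTReduced/ofElt` come from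
-- `QuadraticRootsTothWeylSum.lean` (Part 2).

section adapted

variable {g₁ : SL(2, ℤ)}

/-- The adapted elements `γ_{(k, Q)} = g₁^k ξ_Q ∈ Γ₀(q)`. [folklore] -/
def adaptedElt (g₁ : SL(2, ℤ)) (x : ℤ × TRedOrbit R q) : SL(2, ℤ) := g₁ ^ x.1 * x.2.lift

/-- `γ_{(k,Q)} ∈ Γ₀(q)`. [folklore] -/
theorem adaptedElt_mem (hg₁ : g₁ ∈ CongruenceSubgroup.Gamma0 q) (x : ℤ × TRedOrbit R q) :
    adaptedElt g₁ x ∈ CongruenceSubgroup.Gamma0 q :=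
  Subgroup.mul_mem _ (Subgroup.zpow_mem _ hg₁ _) x.2.lift_mem

/-- `R·γ_{(k,Q)} = Q` for `g₁ ∈ stab R`. [folklore] -/
theorem smul_adaptedElt (hg₁ : g₁ ∈ stab R) (x : ℤ × TRedOrbit R q) :
    smul R (adaptedElt g₁ x) = x.2.1 := by
  rw [adaptedElt, smul_mul, mem_stab_iff.1 (Subgroup.zpow_mem _ hg₁ _), x.2.smul_lift]

/-- **The adapted transversal** `(k, Q) ↦ Γ∞ (g₁^k ξ_Q)⁻¹ ∈ Γ∞∖Γ₀(q)`.
[cite: Toth2000, main theorem (closed geodesics; cf. Ngo2024 §1)] -/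
def adaptedCusp (hg₁ : g₁ ∈ CongruenceSubgroup.Gamma0 q) (x : ℤ × TRedOrbit R q) :
    DFI1995.CuspPair q :=
  cuspOf (adaptedElt g₁ x)⁻¹ (Subgroup.inv_mem _ (adaptedElt_mem hg₁ x))

/-- **Injectivity of the adapted transversal** (`g₁ ∈ stab_q(R)` with `κ(g₁) < 1`, `A > 0`,
`Δ > 0` non-square). [cite: Toth2000, main theorem (closed geodesics; cf. Ngo2024 §1)] -/
theorem adaptedCusp_injective (hA : 0 < R.a) (hΔ : 0 < R.disc) (hsq : ¬ IsSquare R.disc)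
    (hg₁ : g₁ ∈ stabLevel R q) (hκ : deckFactor R g₁ < 1) :
    Function.Injective (adaptedCusp (R := R) hg₁.2) := by
  intro x x' hxx
  have hg₁s : g₁ ∈ stab R := hg₁.1
  -- both `γ_x⁻¹` and `γ_{x'}⁻¹` are `±T^m σ_p` for the same `p`
  obtain ⟨m, hm⟩ := exists_eq_T_zpow_mul_cuspOf (Subgroup.inv_mem _ (adaptedElt_mem hg₁.2 x))
  obtain ⟨m', hm'⟩ := exists_eq_T_zpow_mul_cuspOf (Subgroup.inv_mem _ (adaptedElt_mem hg₁.2 x'))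
  change cuspOf (adaptedElt g₁ x)⁻¹ _ = cuspOf (adaptedElt g₁ x')⁻¹ _ at hxx
  rw [hxx] at hm
  set σ := (cuspOf (adaptedElt g₁ x')⁻¹ (Subgroup.inv_mem _ (adaptedElt_mem hg₁.2 x'))).toSL
  -- `γ_{x'} = s · γ_x · T^{m - m'}` with `s = ±1`
  have key : ∃ s : SL(2, ℤ), (s = 1 ∨ s = -1) ∧
      adaptedElt g₁ x' = s * adaptedElt g₁ x * T ^ (m - m') := by
    -- from `γ_x⁻¹ = ±T^m σ`, `γ_{x'}⁻¹ = ±T^{m'} σ`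
    have e1 : adaptedElt g₁ x = σ⁻¹ * T ^ (-m) ∨ adaptedElt g₁ x = -(σ⁻¹ * T ^ (-m)) := by
      rcases hm with h | h
      · left
        have := congrArg (·⁻¹) h
        simp only [inv_inv, mul_inv_rev, zpow_neg] at this ⊢
        exact this
      · right
        have := congrArg (·⁻¹) h
        simp only [inv_inv, inv_neg, mul_inv_rev, zpow_neg] at this ⊢
        exact this
    have e2 : adaptedElt g₁ x' = σ⁻¹ * T ^ (-m') ∨ adaptedElt g₁ x' = -(σ⁻¹ * T ^ (-m')) := by
      rcases hm' with h | h
      · left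
        have := congrArg (·⁻¹) h
        simp only [inv_inv, mul_inv_rev, zpow_neg] at this ⊢
        exact this
      · right
        have := congrArg (·⁻¹) h
        simp only [inv_inv, inv_neg, mul_inv_rev, zpow_neg] at this ⊢
        exact this
    have hT : σ⁻¹ * T ^ (-m') = σ⁻¹ * T ^ (-m) * T ^ (m - m') := by
      rw [mul_assoc, ← zpow_add]; congr 2; ring
    rcases e1 with h1 | h1 <;> rcases e2 with h2 | h2
    · exact ⟨1, Or.inl rfl, by rw [one_mul, h2, h1, hT]⟩
    · exact ⟨-1, Or.inr rfl, by rw [h2, h1, hT]; simp⟩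
    · exact ⟨-1, Or.inr rfl, by rw [h2, h1, hT]; simp⟩
    · exact ⟨1, Or.inl rfl, by rw [one_mul, h2, h1, hT]; simp⟩
  obtain ⟨s, hs, hrel⟩ := key
  have hsmul_s : ∀ Q : BinQF, smul Q s = Q := by
    intro Q; rcases hs with rfl | rfl
    · exact smul_one Q
    · rw [smul_neg, smul_one]
  -- apply to `R`: `Q' = Q·T^{m-m'}`
  have hQQ : x'.2.1 = smul x.2.1 (T ^ (m - m')) := by
    rw [← smul_adaptedElt hg₁s x', hrel, smul_mul, smul_mul, hsmul_s, smul_adaptedElt hg₁s x]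
  have hAx : x.2.1.a ≠ 0 := by
    rw [← smul_adaptedElt hg₁s x]
    exact a_ne_zero_of_not_isSquare (not_isSquare_smul_disc hsq _)
  obtain ⟨hj, hQeq⟩ := isTReduced_T_zpow_unique hAx x.2.isTReduced x'.2.isTReduced hQQ
  have hx2 : x'.2 = x.2 := Subtype.ext hQeq
  -- now `g₁^{k'} ξ_Q = s g₁^k ξ_Q`, so `g₁^{k'-k} = s`, forcing `k' = k`
  rw [hj, zpow_zero, mul_one, adaptedElt, adaptedElt, hx2] at hrel
  have hpow : g₁ ^ x'.1 = s * g₁ ^ x.1 := mul_right_cancel (by rw [hrel, mul_assoc])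
  have hpow' : g₁ ^ (x'.1 - x.1) = s := by
    rw [zpow_sub, hpow, mul_inv_cancel_right]
  have hk : x'.1 = x.1 := by
    rcases hs with rfl | rfl
    · have h1 : deckFactor R (g₁ ^ (x'.1 - x.1)) = deckFactor R (g₁ ^ (0 : ℤ)) := by
        rw [hpow', zpow_zero]
      have := deck_zpow_injective hA.ne' hΔ hg₁s hκ h1
      omega
    · exact absurd hpow' (deck_zpow_ne_neg_one hA.ne' hΔ hg₁s hκ _)
  exact (Prod.ext hk hx2).symm

/-- **Surjectivity of the adapted transversal**: every coset `Γ∞σ_p` is `Γ∞(g₁^kξ_Q)⁻¹` — write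
`R·σ_p⁻¹ = Q·T^{-e}` with `Q` `T`-reduced, so `σ_p⁻¹T^{e}ξ_Q⁻¹ ∈ stab_q(R) = {±g₁^k}`.
[cite: Toth2000, main theorem (closed geodesics; cf. Ngo2024 §1)] -/
theorem adaptedCusp_surjective (hsq : ¬ IsSquare R.disc) (hg₁ : g₁ ∈ stabLevel R q)
    (hgen : ∀ g ∈ stabLevel R q, ∃ k : ℤ, g = g₁ ^ k ∨ g = -g₁ ^ k) :
    Function.Surjective (adaptedCusp (R := R) hg₁.2) := by
  intro p
  have hσ : p.toSL⁻¹ ∈ CongruenceSubgroup.Gamma0 q := Subgroup.inv_mem _ p.toSL_mem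
  set Q : TRedOrbit R q := TRedOrbit.ofElt R hsq hσ with hQ
  -- `R·(σ⁻¹ T^e) = Q = R·ξ_Q`
  set e : ℤ := tExp (smul R p.toSL⁻¹) with he
  have h1 : smul R (p.toSL⁻¹ * T ^ e) = Q.1 := by rw [smul_mul]; rfl
  have h2 : smul R Q.lift = Q.1 := Q.smul_lift
  have hstab : p.toSL⁻¹ * T ^ e * Q.lift⁻¹ ∈ stab R := by
    have := smul_eq_smul_iff.1 (h2.trans h1.symm)
    -- `smul R ξ = smul R ξ' ↔ ξ' * ξ⁻¹ ∈ stab R` with `ξ = Q.lift`, `ξ' = σ⁻¹ T^e`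
    exact this
  have hT0 : T ∈ CongruenceSubgroup.Gamma0 q := by
    rw [CongruenceSubgroup.Gamma0_mem]; simp [ModularGroup.T]
  have hlev : p.toSL⁻¹ * T ^ e * Q.lift⁻¹ ∈ stabLevel R q :=
    ⟨hstab, Subgroup.mul_mem _ (Subgroup.mul_mem _ hσ (Subgroup.zpow_mem _ hT0 _))
      (Subgroup.inv_mem _ Q.lift_mem)⟩
  obtain ⟨k, hk⟩ := hgen _ hlev
  refine ⟨(k, Q), ?_⟩
  -- `(g₁^k ξ_Q)⁻¹ = ± T^{-e} σ_p`
  rcases hk with h | h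
  · refine cuspOf_eq_of_eq _ true (-e) p ?_
    simp only [DFI1995.sgn_true]
    rw [adaptedElt]
    have : g₁ ^ k * Q.lift = p.toSL⁻¹ * T ^ e := by rw [← h, inv_mul_cancel_right]
    rw [this, mul_inv_rev, inv_inv, zpow_neg]
  · refine cuspOf_eq_of_eq _ false (-e) p ?_
    simp only [DFI1995.sgn_false]
    rw [adaptedElt]
    have : g₁ ^ k * Q.lift = -(p.toSL⁻¹ * T ^ e) := by
      rw [← neg_eq_iff_eq_neg.2 h, neg_mul, inv_mul_cancel_right]
    rw [this, inv_neg, mul_inv_rev, inv_inv, zpow_neg]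

/-- **`ℤ × TRedOrbit R q ≃ Γ∞∖Γ₀(q)`**, the transversal adapted to the closed geodesic of `R`:
`(k, Q) ↦ Γ∞ (g₁^k ξ_Q)⁻¹`.  Compare `RootForms.tothEquiv : (Bool × ℤ) × TRedOrbit R q ≃ PrimVec q`
(`QuadraticRootsTothWeylSum.lean`), which indexes the first columns `±g₁^k ξ_Q e₁` WITH their sign
(`PrimVec q` ≅ `Γ₀(q)∕⟨T⟩`); here the quotient is by `Γ∞ = {±Tⁿ}` on the left of the inverses, so
the sign is absorbed and only `ℤ × TRedOrbit` remains.
[cite: Toth2000, main theorem (closed geodesics; cf. Ngo2024 §1)] -/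
def adaptedEquiv (hA : 0 < R.a) (hΔ : 0 < R.disc) (hsq : ¬ IsSquare R.disc)
    (hg₁ : g₁ ∈ stabLevel R q) (hκ : deckFactor R g₁ < 1)
    (hgen : ∀ g ∈ stabLevel R q, ∃ k : ℤ, g = g₁ ^ k ∨ g = -g₁ ^ k) :
    ℤ × TRedOrbit R q ≃ DFI1995.CuspPair q :=
  Equiv.ofBijective _ ⟨adaptedCusp_injective hA hΔ hsq hg₁ hκ, adaptedCusp_surjective hsq hg₁ hgen⟩

/-- **The Poincaré series in adapted coordinates**:
`P_φ(z) = ∑'_{(k, Q)} φ(ξ_Q⁻¹ g₁^{-k} z)`. [cite: Toth2000, main theorem (closed geodesics; cf. Ngo2024 §1)] -/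
theorem poincareFn_eq_tsum_adapted (hA : 0 < R.a) (hΔ : 0 < R.disc) (hsq : ¬ IsSquare R.disc)
    (hg₁ : g₁ ∈ stabLevel R q) (hκ : deckFactor R g₁ < 1)
    (hgen : ∀ g ∈ stabLevel R q, ∃ k : ℤ, g = g₁ ^ k ∨ g = -g₁ ^ k)
    {φ : ℍ → ℂ} (hT : ∀ z : ℍ, φ (T • z) = φ z) (z : ℍ) :
    poincareFn q φ z = ∑' x : ℤ × TRedOrbit R q, φ ((adaptedElt g₁ x)⁻¹ • z) := by
  rw [poincareFn, ← Equiv.tsum_eq (adaptedEquiv hA hΔ hsq hg₁ hκ hgen)]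
  refine tsum_congr fun x => ?_
  exact apply_cuspOf_smul hT _ z

end adapted

/-! ### The geodesic weight -/

section weight

variable {Q : BinQF}

/-- The parametrisation of the geodesic of a form with `A ≠ 0`, `Δ > 0`: that of `Q` for `A > 0`,
that of the opposite form `−Q` for `A < 0` (junk value `i` otherwise). [folklore] -/
def axisPt₁ (Q : BinQF) (t : ℝ) : ℍ :=
  if h : 0 < Q.a ∧ 0 < Q.disc then axisPt₀ Q h.1 h.2 t
  else if h' : Q.a < 0 ∧ 0 < Q.disc then
    axisPt₀ (negForm Q) (negForm_a_pos.2 h'.1) ((negForm_disc Q).symm ▸ h'.2) t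
  else UpperHalfPlane.I

/-- `axisPt₁ = axisPt₀` for `A > 0`. [folklore] -/
theorem axisPt₁_of_pos (hA : 0 < Q.a) (hΔ : 0 < Q.disc) (t : ℝ) :
    axisPt₁ Q t = axisPt₀ Q hA hΔ t := by
  rw [axisPt₁, dif_pos ⟨hA, hΔ⟩]

/-- `axisPt₁ Q = axisPt₀ (−Q)` for `A < 0`. [folklore] -/
theorem axisPt₁_of_neg (hA : Q.a < 0) (hΔ : 0 < Q.disc) (hA' : 0 < (negForm Q).a)
    (hΔ' : 0 < (negForm Q).disc) (t : ℝ) :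
    axisPt₁ Q t = axisPt₀ (negForm Q) hA' hΔ' t := by
  rw [axisPt₁, dif_neg (fun h => lt_asymm hA h.1), dif_pos ⟨hA, hΔ⟩]

/-- The **geodesic weight** `𝒲_φ(Q) = ∫_{S_Q} φ ds = ∫_{t>0} φ(P(t)) dt/t` of a form with
`A ≠ 0`, `Δ > 0` (`P` the parametrisation of the semicircle of `Q`, resp. `−Q`).
[cite: Toth2000, main theorem (sums over closed geodesics; cf. Ngo2024 §1)] -/
def geodWeight (φ : ℍ → ℂ) (Q : BinQF) : ℂ := ∫ t in Set.Ioi 0, φ (axisPt₁ Q t) / t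

/-- `𝒲_φ(Q)` for `A > 0`. [folklore] -/
theorem geodWeight_of_pos (φ : ℍ → ℂ) (hA : 0 < Q.a) (hΔ : 0 < Q.disc) :
    geodWeight φ Q = ∫ t in Set.Ioi 0, φ (axisPt₀ Q hA hΔ t) / t := by
  simp_rw [geodWeight, axisPt₁_of_pos hA hΔ]

/-- `𝒲_φ(Q)` for `A < 0`. [folklore] -/
theorem geodWeight_of_neg (φ : ℍ → ℂ) (hA : Q.a < 0) (hΔ : 0 < Q.disc) (hA' : 0 < (negForm Q).a)
    (hΔ' : 0 < (negForm Q).disc) :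
    geodWeight φ Q = ∫ t in Set.Ioi 0, φ (axisPt₀ (negForm Q) hA' hΔ' t) / t := by
  simp_rw [geodWeight, axisPt₁_of_neg hA hΔ hA' hΔ']

/-- For the kernel `φ(z) = e(η Re z) Ψ(Im z)` and `A > 0`: `𝒲_φ(Q) = e(η x₀) 𝒯_ηΨ(r)`
(`…LevelOrbitalWeight.orbitalWeight_eq`). [cite: Toth2000, main theorem (sums over closed geodesics; cf. Ngo2024 §1)] -/
theorem geodWeight_kernel_of_pos (hA : 0 < Q.a) (hΔ : 0 < Q.disc) (η : ℝ) (Ψ : ℝ → ℂ) :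
    geodWeight (fun z : ℍ => eTwoPi (η * (z : ℂ).re) * Ψ (z : ℂ).im) Q =
      eTwoPi (η * center Q) * geodTransform η Ψ (radius Q) := by
  rw [geodWeight_of_pos _ hA hΔ]
  exact orbitalWeight_eq hA hΔ η Ψ

/-! ### Haar-measure bookkeeping on `(0, ∞)` -/

/-- Dilation invariance of `ds/s`: `∫_{s>0} G(κ s) ds/s = ∫_{u>0} G(u) du/u` (`κ > 0`). [folklore] -/
theorem integral_Ioi_comp_mul_div (G : ℝ → ℂ) {κ : ℝ} (hκ : 0 < κ) :
    ∫ s in Set.Ioi (0 : ℝ), G (κ * s) / s = ∫ u in Set.Ioi (0 : ℝ), G u / u := by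
  have h1 : ∫ s in Set.Ioi (0 : ℝ), G (κ * s) / s =
      ∫ s in Set.Ioi (0 : ℝ), (κ : ℂ) * (G (κ * s) / ((κ * s : ℝ) : ℂ)) := by
    refine setIntegral_congr_fun measurableSet_Ioi fun s hs => ?_
    have hs0 : (s : ℂ) ≠ 0 := by exact_mod_cast (ne_of_gt hs)
    have hκ0 : (κ : ℂ) ≠ 0 := by exact_mod_cast hκ.ne'
    push_cast
    field_simp
  rw [h1, integral_const_mul]
  have h2 := integral_comp_mul_left_Ioi (fun u : ℝ => G u / (u : ℂ)) 0 hκ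
  simp only [mul_zero] at h2
  rw [h2, Complex.real_smul]
  push_cast
  have hκ0 : (κ : ℂ) ≠ 0 := by exact_mod_cast hκ.ne'
  field_simp

/-- Inversion invariance of `ds/s`: `∫_{s>0} G(c/s) ds/s = ∫_{u>0} G(u) du/u` (`c > 0`). [folklore] -/
theorem integral_Ioi_comp_div_div (G : ℝ → ℂ) {c : ℝ} (hc : 0 < c) :
    ∫ s in Set.Ioi (0 : ℝ), G (c / s) / s = ∫ u in Set.Ioi (0 : ℝ), G u / u := by
  -- `u = 1/s` then dilation
  have h1 := integral_comp_rpow_Ioi (fun y : ℝ => G (c * y) / (y : ℂ)) (p := -1) (by norm_num)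
  have h2 : ∫ s in Set.Ioi (0 : ℝ), G (c / s) / s =
      ∫ x in Set.Ioi (0 : ℝ), (|(-1 : ℝ)| * x ^ ((-1 : ℝ) - 1)) • (G (c * x ^ (-1 : ℝ)) / ((x ^ (-1 : ℝ) : ℝ) : ℂ)) := by
    refine setIntegral_congr_fun measurableSet_Ioi fun x hx => ?_
    have hx0 : (0 : ℝ) < x := hx
    simp only [abs_neg, abs_one, one_mul, Real.rpow_neg_one]
    rw [show ((-1 : ℝ) - 1) = ((-2 : ℤ) : ℝ) by norm_num, Real.rpow_intCast, Complex.real_smul,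
      div_eq_mul_inv c]
    have hxC : (x : ℂ) ≠ 0 := by exact_mod_cast hx0.ne'
    push_cast
    field_simp
  rw [h2, h1]
  exact integral_Ioi_comp_mul_div G hc

end weight

/-! ### The unfolding -/

section unfold

variable {g₁ : SL(2, ℤ)}

/-- The action of `SL₂(ℤ)` on `ℍ` is continuous in the point. [folklore] -/
theorem continuous_sl_smul (g : SL(2, ℤ)) : Continuous fun z : ℍ => g • z := by
  have : (fun z : ℍ => g • z) = fun z : ℍ => ((g : GL (Fin 2) ℝ)) • z := by
    funext z; exact ModularGroup.sl_moeb g z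
  rw [this]
  exact continuous_const_smul _

/-- Interval integrability of `t ↦ φ(γ • P_R(t))/t` between positive endpoints. [folklore] -/
theorem intervalIntegrable_smul_axis (hA : 0 < R.a) (hΔ : 0 < R.disc) {φ : ℍ → ℂ}
    (hφc : Continuous φ) (γ : SL(2, ℤ)) {a b : ℝ} (ha : 0 < a) (hb : 0 < b) :
    IntervalIntegrable (fun t : ℝ => φ (γ • axisPt₀ R hA hΔ t) / t) volume a b :=
  intervalIntegrable_axis hA hΔ (f := fun z => φ (γ • z))
    ((hφc.comp (continuous_sl_smul γ)).comp_continuousOn (continuousOn_axisPt₀ hA hΔ)) ha hb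

/-- **Powers of the deck generator dilate the axis**: `(g₁^k)⁻¹ • P_R(t) = P_R(b^k t)`,
`b = κ(g₁)⁻¹`. [cite: Toth2000, main theorem (closed geodesics; cf. Ngo2024 §1)] -/
theorem zpow_inv_smul_axisPt₀ (hA : 0 < R.a) (hΔ : 0 < R.disc) (hg₁ : g₁ ∈ stab R) (k : ℤ)
    {t : ℝ} (ht : 0 < t) :
    (g₁ ^ k)⁻¹ • axisPt₀ R hA hΔ t = axisPt₀ R hA hΔ ((deckFactor R g₁)⁻¹ ^ k * t) := by
  have hmem : (g₁ ^ k)⁻¹ ∈ stab R := Subgroup.inv_mem _ (Subgroup.zpow_mem _ hg₁ k)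
  have hκ : deckFactor R (g₁ ^ k)⁻¹ = (deckFactor R g₁)⁻¹ ^ k := by
    rw [deckFactor_inv hA.ne' hΔ (Subgroup.zpow_mem _ hg₁ k), deckFactor_zpow hA.ne' hΔ hg₁,
      inv_zpow]
  have hpos : 0 < (deckFactor R g₁)⁻¹ ^ k * t :=
    mul_pos (zpow_pos (inv_pos.2 (deckFactor_pos hA.ne' hΔ.le hg₁)) k) ht
  rw [axisPt₀_of_pos hA hΔ ht, axisPt₀_of_pos hA hΔ hpos, smul_axisPt_of_mem_stab hA hΔ hmem ht]
  exact axisPt_congr hA hΔ _ _ (by rw [hκ])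

/-- The box containing one period of the axis: for `t ∈ [κ₁, 1]` (`0 < κ₁`),
`|Re P_R(t)| ≤ |x₀| + |r|` and `r κ₁ ≤ Im P_R(t) ≤ r`. [folklore] -/
theorem axisPt₀_mem_box (hA : 0 < R.a) (hΔ : 0 < R.disc) {κ₁ t : ℝ} (hκ₁ : 0 < κ₁)
    (ht : t ∈ Set.Icc κ₁ 1) :
    |(axisPt₀ R hA hΔ t).re| ≤ |center R| + |radius R| ∧
      radius R * κ₁ ≤ (axisPt₀ R hA hΔ t).im ∧ (axisPt₀ R hA hΔ t).im ≤ radius R := by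
  have ht0 : 0 < t := hκ₁.trans_le ht.1
  have hr := radius_pos hA hΔ
  have hre : (axisPt₀ R hA hΔ t).re = (axisPtC R t).re := by
    rw [← UpperHalfPlane.coe_re, coe_axisPt₀_of_pos hA hΔ ht0]
  have him : (axisPt₀ R hA hΔ t).im = (axisPtC R t).im := by
    rw [← UpperHalfPlane.coe_im, coe_axisPt₀_of_pos hA hΔ ht0]
  rw [hre, him, axisPtC_re_eq, axisPtC_im_eq]
  have h1t : (0 : ℝ) < 1 + t ^ 2 := by positivity
  refine ⟨?_, ?_, ?_⟩
  · have hq : |(1 - t ^ 2) / (1 + t ^ 2)| ≤ 1 := by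
      rw [abs_div, abs_of_pos h1t, div_le_one h1t]
      have := abs_sub_abs_le_abs_sub (1 : ℝ) (t ^ 2)
      rw [abs_le]
      constructor <;> nlinarith [sq_nonneg t, abs_nonneg (1 - t ^ 2), abs_sub_comm (1:ℝ) (t^2),
        abs_le.1 (show |1 - t ^ 2| ≤ |(1 - t ^ 2)| from le_rfl), le_abs_self (1 - t^2), neg_abs_le (1 - t^2)]
    calc |center R + radius R * ((1 - t ^ 2) / (1 + t ^ 2))|
        ≤ |center R| + |radius R * ((1 - t ^ 2) / (1 + t ^ 2))| := abs_add_le _ _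
      _ = |center R| + |radius R| * |(1 - t ^ 2) / (1 + t ^ 2)| := by rw [abs_mul]
      _ ≤ |center R| + |radius R| * 1 := by gcongr
      _ = |center R| + |radius R| := by rw [mul_one]
  · -- `2t/(1+t²) ≥ t ≥ κ₁` for `t ≤ 1`
    have h2 : t ≤ 2 * t / (1 + t ^ 2) := by
      rw [le_div_iff₀ h1t]
      nlinarith [ht.2, ht0, sq_nonneg t]
    calc radius R * κ₁ ≤ radius R * t := mul_le_mul_of_nonneg_left ht.1 hr.le
      _ ≤ radius R * (2 * t / (1 + t ^ 2)) := mul_le_mul_of_nonneg_left h2 hr.le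
  · exact (axisPtC_im_eq R t) ▸ axisPtC_im_le hr.le t

/-- **Telescoping over one deck orbit.**  For `0 < κ₁ < 1`, `b = κ₁⁻¹`, a function `F` on
`(0, ∞)` with `F(s)/s` interval-integrable between positive points, and a finite set `K` of
exponents outside which `F` vanishes on `[b^k κ₁, b^k]`:
`∑_{k ∈ K} ∫_{b^k κ₁}^{b^k} F(s) ds/s = ∫_{s>0} F(s) ds/s` (the intervals `[b^{k-1}, b^k]` tile
`(0, ∞)`). [folklore] -/
theorem sum_integral_deck_intervals {κ₁ : ℝ} (hκ0 : 0 < κ₁) (hκ1 : κ₁ < 1) {F : ℝ → ℂ}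
    (hint : ∀ a b : ℝ, 0 < a → 0 < b → IntervalIntegrable (fun s => F s / s) volume a b)
    (K : Finset ℤ)
    (hK : ∀ k : ℤ, k ∉ K → ∀ s ∈ Set.Icc (κ₁⁻¹ ^ k * κ₁) (κ₁⁻¹ ^ k), F s = 0) :
    ∑ k ∈ K, ∫ s in (κ₁⁻¹ ^ k * κ₁)..(κ₁⁻¹ ^ k), F s / s = ∫ s in Set.Ioi 0, F s / s := by
  set b : ℝ := κ₁⁻¹ with hb
  have hb1 : 1 < b := one_lt_inv₀ hκ0 |>.2 hκ1
  have hb0 : 0 < b := zero_lt_one.trans hb1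
  have hbκ : b * κ₁ = 1 := inv_mul_cancel₀ hκ0.ne'
  -- adjacent endpoints: `b^(k+1) κ₁ = b^k`
  have hadj : ∀ k : ℤ, b ^ (k + 1) * κ₁ = b ^ k := by
    intro k; rw [zpow_add_one₀ hb0.ne', mul_assoc, hbκ, mul_one]
  -- an interval `[k₀, k₁]` of exponents containing `K`
  obtain ⟨k₀, k₁, hk01, hKsub⟩ : ∃ k₀ k₁ : ℤ, k₀ ≤ k₁ ∧ ∀ k ∈ K, k₀ ≤ k ∧ k ≤ k₁ := by
    rcases K.eq_empty_or_nonempty with hK0 | hKne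
    · exact ⟨0, 0, le_rfl, by simp [hK0]⟩
    · exact ⟨K.min' hKne, K.max' hKne, Finset.min'_le_max' K hKne, fun k hk =>
        ⟨Finset.min'_le K k hk, Finset.le_max' K k hk⟩⟩
  -- the integral over `[b^k κ₁, b^k]` vanishes for `k ∉ K`
  have hzero : ∀ k : ℤ, k ∉ K → ∫ s in (b ^ k * κ₁)..(b ^ k), F s / s = 0 := by
    intro k hk
    rw [intervalIntegral.integral_congr (g := fun _ => (0 : ℂ)), intervalIntegral.integral_zero]
    intro s hs
    have hle : b ^ k * κ₁ ≤ b ^ k := by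
      calc b ^ k * κ₁ ≤ b ^ k * 1 := mul_le_mul_of_nonneg_left hκ1.le (zpow_pos hb0 k).le
        _ = b ^ k := mul_one _
    rw [Set.uIcc_of_le hle] at hs
    simp only
    rw [hK k hk s hs, zero_div]
  -- extend the sum to `[k₀, k₁]`
  have hsum : ∑ k ∈ K, ∫ s in (b ^ k * κ₁)..(b ^ k), F s / s =
      ∑ k ∈ Finset.Icc k₀ k₁, ∫ s in (b ^ k * κ₁)..(b ^ k), F s / s := by
    apply Finset.sum_subset
    · intro k hk; exact Finset.mem_Icc.2 (hKsub k hk)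
    · intro k _ hk; exact hzero k hk
  rw [hsum]
  -- reindex by `n = k - k₀ ∈ range N`
  set N : ℕ := (k₁ - k₀ + 1).toNat with hN
  have hNZ : (N : ℤ) = k₁ - k₀ + 1 := by rw [hN, Int.toNat_of_nonneg (by omega)]
  set a : ℕ → ℝ := fun n => b ^ (k₀ + n) * κ₁ with ha
  have hreindex : ∑ k ∈ Finset.Icc k₀ k₁, ∫ s in (b ^ k * κ₁)..(b ^ k), F s / s =
      ∑ n ∈ Finset.range N, ∫ s in (a n)..(a (n + 1)), F s / s := by
    refine Finset.sum_nbij' (fun k => (k - k₀).toNat) (fun n => k₀ + n) ?_ ?_ ?_ ?_ ?_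
    · intro k hk
      rw [Finset.mem_Icc] at hk
      rw [Finset.mem_range]
      have : ((k - k₀).toNat : ℤ) < N := by rw [Int.toNat_of_nonneg (by omega), hNZ]; omega
      exact_mod_cast this
    · intro n hn
      rw [Finset.mem_range] at hn
      rw [Finset.mem_Icc]
      constructor
      · omega
      · have : (n : ℤ) < N := by exact_mod_cast hn
        rw [hNZ] at this; omega
    · intro k hk
      rw [Finset.mem_Icc] at hk
      show k₀ + (((k - k₀).toNat : ℕ) : ℤ) = k
      rw [Int.toNat_of_nonneg (by omega)]; omega
    · intro n hn
      show (k₀ + (n : ℤ) - k₀).toNat = n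
      rw [add_sub_cancel_left, Int.toNat_natCast]
    · intro k hk
      rw [Finset.mem_Icc] at hk
      simp only [ha]
      have e1 : k₀ + ((k - k₀).toNat : ℤ) = k := by rw [Int.toNat_of_nonneg (by omega)]; omega
      rw [Nat.cast_add, Nat.cast_one, ← add_assoc, e1, hadj]
  rw [hreindex, intervalIntegral.sum_integral_adjacent_intervals]
  swap
  · intro n _
    exact hint _ _ (mul_pos (zpow_pos hb0 _) hκ0) (mul_pos (zpow_pos hb0 _) hκ0)
  -- `∫_{a 0}^{a N} = ∫_{Ioi 0}`
  have ha0 : 0 < a 0 := mul_pos (zpow_pos hb0 _) hκ0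
  have haN : a N = b ^ k₁ := by
    simp only [ha]
    rw [show k₀ + (N : ℤ) = k₁ + 1 by rw [hNZ]; ring, hadj]
  have hle : a 0 ≤ a N := by
    simp only [ha]
    exact mul_le_mul_of_nonneg_right (zpow_le_zpow_right₀ hb1.le (by omega)) hκ0.le
  rw [intervalIntegral.integral_of_le hle]
  symm
  apply setIntegral_eq_of_subset_of_forall_sdiff_eq_zero measurableSet_Ioi
  · intro s hs; exact ha0.trans hs.1
  · rintro s ⟨hs0, hsn⟩
    -- `s > 0` outside `(a 0, a N]`: find its deck interval
    obtain ⟨n, hn1, hn2⟩ := exists_mem_Ioc_zpow (hs0 : 0 < s) hb1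
    -- `s ∈ (b^n, b^(n+1)] = (b^(n+1) κ₁, b^(n+1)]`
    have hsI : s ∈ Set.Icc (b ^ (n + 1) * κ₁) (b ^ (n + 1)) := ⟨by rw [hadj]; exact hn1.le, hn2⟩
    have hnK : n + 1 ∉ K := by
      intro hmem
      obtain ⟨h1, h2⟩ := hKsub _ hmem
      apply hsn
      constructor
      · -- `a 0 = b^k₀ κ₁ ≤ b^n κ₁ < b^n < s`
        calc a 0 = b ^ (k₀ : ℤ) * κ₁ := by simp [ha]
          _ ≤ b ^ (n + 1) * κ₁ := mul_le_mul_of_nonneg_right (zpow_le_zpow_right₀ hb1.le h1) hκ0.le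
          _ = b ^ n := hadj n
          _ < s := hn1
      · calc s ≤ b ^ (n + 1) := hn2
          _ ≤ b ^ k₁ := zpow_le_zpow_right₀ hb1.le h2
          _ = a N := haN.symm
    rw [hK _ hnK s hsI, zero_div]

variable (hA : 0 < R.a) (hΔ : 0 < R.disc) (hsq : ¬ IsSquare R.disc)
  (hg₁ : g₁ ∈ stabLevel R q) (hκ : deckFactor R g₁ < 1)
  (hgen : ∀ g ∈ stabLevel R q, ∃ k : ℤ, g = g₁ ^ k ∨ g = -g₁ ^ k)
  {φ : ℍ → ℂ} (hφc : Continuous φ) (hT : ∀ z : ℍ, φ (T • z) = φ z)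
  {Y : ℝ} (hsupp : ∀ z : ℍ, z.im < Y → φ z = 0)

include hsq hg₁ hκ hsupp in
/-- **The finite support over one period.**  There is a finite set `𝓕` of adapted indices
outside which `φ((g₁^kξ_Q)⁻¹ • P_R(t))` vanishes for all `t ∈ [κ₁, 1]`. [folklore] -/
theorem exists_finset_adapted_support (hY : 0 < Y) :
    ∃ 𝓕 : Finset (ℤ × TRedOrbit R q), ∀ x ∉ 𝓕, ∀ t ∈ Set.Icc (deckFactor R g₁) 1,
      φ ((adaptedElt g₁ x)⁻¹ • axisPt₀ R hA hΔ t) = 0 := by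
  have hκ0 := deckFactor_pos hA.ne' hΔ.le hg₁.1
  have hr := radius_pos hA hΔ
  have hfin := finite_cuspPairs_above q (X₀ := |center R| + |radius R|)
    (y₀ := radius R * deckFactor R g₁) (y₁ := radius R) (Y := Y) (mul_pos hr hκ0) hY
  have hinj := adaptedCusp_injective hA hΔ hsq hg₁ hκ
  refine ⟨(hfin.preimage hinj.injOn).toFinset, ?_⟩
  intro x hx t ht
  rw [Set.Finite.mem_toFinset, Set.mem_preimage, Set.mem_setOf_eq] at hx
  push Not at hx
  apply hsupp
  obtain ⟨h1, h2, h3⟩ := axisPt₀_mem_box hA hΔ hκ0 ht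
  have := hx (axisPt₀ R hA hΔ t) h1 h2 h3
  rwa [adaptedCusp, im_cuspOf_smul] at this

/-- `(g₁^kξ_Q)⁻¹ • P_R(t) = ξ_Q⁻¹ • P_R(b^k t)`. [folklore] -/
theorem adaptedElt_inv_smul (hg₁s : g₁ ∈ stab R) (x : ℤ × TRedOrbit R q) {t : ℝ}
    (ht : 0 < t) :
    (adaptedElt g₁ x)⁻¹ • axisPt₀ R hA hΔ t =
      x.2.lift⁻¹ • axisPt₀ R hA hΔ ((deckFactor R g₁)⁻¹ ^ x.1 * t) := by
  rw [adaptedElt, mul_inv_rev, mul_smul, zpow_inv_smul_axisPt₀ hA hΔ hg₁s x.1 ht]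

/-- Transport of the weight, `A > 0` case: `ξ⁻¹ • P_R(s) = P_Q(κ s)` when `Q·ξ⁻¹ = R`,
`Q.a > 0`. [cite: Toth2000, main theorem (closed geodesics; cf. Ngo2024 §1)] -/
theorem inv_smul_axisPt₀_of_pos {Q : BinQF} (hQ : 0 < Q.a) (hΔQ : 0 < Q.disc) (ξ : SL(2, ℤ))
    (hR : smul Q ξ⁻¹ = R) {s : ℝ} (hs : 0 < s) :
    ξ⁻¹ • axisPt₀ R hA hΔ s = axisPt₀ Q hQ hΔQ (deckFactor Q ξ⁻¹ * s) ∧ 0 < deckFactor Q ξ⁻¹ := by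
  subst hR
  have hpos := deckFactor_pos_of_smul_a_pos hQ hΔQ hA
  refine ⟨?_, hpos⟩
  rw [axisPt₀_of_pos hA hΔ hs, axisPt₀_of_pos hQ hΔQ (mul_pos hpos hs)]
  exact smul_axisPt_smul hQ hΔQ ξ⁻¹ hA hΔ hs

/-- Transport of the weight, `A < 0` case: `ξ⁻¹ • P_R(s) = P_{−Q}(c/s)`, `c > 0`, when
`Q·ξ⁻¹ = R`, `Q.a < 0`. [cite: Toth2000, main theorem (closed geodesics; cf. Ngo2024 §1)] -/
theorem inv_smul_axisPt₀_of_neg {Q : BinQF}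
    (hQ' : 0 < (negForm Q).a) (hΔQ' : 0 < (negForm Q).disc) (ξ : SL(2, ℤ))
    (hR : smul Q ξ⁻¹ = R) {s : ℝ} (hs : 0 < s) :
    ξ⁻¹ • axisPt₀ R hA hΔ s = axisPt₀ (negForm Q) hQ' hΔQ' (-deckFactor (negForm Q) ξ⁻¹ / s) ∧
      deckFactor (negForm Q) ξ⁻¹ < 0 := by
  have hneg : (smul (negForm Q) ξ⁻¹).a < 0 := by
    rw [smul_negForm, negForm_a, neg_neg_iff_pos, hR]; exact hA
  have hκneg := deckFactor_neg_of_smul_a_neg hQ' hΔQ' hneg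
  refine ⟨?_, hκneg⟩
  have hA'' : 0 < (negForm (smul (negForm Q) ξ⁻¹)).a := by
    rw [smul_negForm, negForm_negForm, hR]; exact hA
  have hΔ'' : 0 < (negForm (smul (negForm Q) ξ⁻¹)).disc := by
    rw [smul_negForm, negForm_negForm, hR]; exact hΔ
  have key := smul_axisPt_negForm_smul hQ' hΔQ' ξ⁻¹ hneg hA'' hΔ'' hs
  have hcs : 0 < -deckFactor (negForm Q) ξ⁻¹ / s := div_pos (neg_pos.2 hκneg) hs
  rw [axisPt₀_of_pos hA hΔ hs, axisPt₀_of_pos hQ' hΔQ' hcs, ← key]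
  congr 1
  -- `axisPt (negForm (smul (negForm Q) ξ⁻¹)) … s = axisPt R … s` as `negForm (…) = R`
  have e : negForm (smul (negForm Q) ξ⁻¹) = R := by rw [smul_negForm, negForm_negForm, hR]
  apply UpperHalfPlane.ext
  rw [coe_axisPt, coe_axisPt, e]

include hA hΔ hsq in
/-- **The weight of an orbit element**: `∫_{s>0} φ(ξ_Q⁻¹ • P_R(s)) ds/s = 𝒲_φ(Q)`.
[cite: Toth2000, main theorem (sums over closed geodesics; cf. Ngo2024 §1)] -/
theorem integral_Ioi_lift_inv_smul_eq_geodWeight (Q : TRedOrbit R q) :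
    ∫ s in Set.Ioi 0, φ (Q.lift⁻¹ • axisPt₀ R hA hΔ s) / s = geodWeight φ Q.1 := by
  have hR : smul Q.1 Q.lift⁻¹ = R := by rw [← Q.smul_lift, smul_mul_inv]
  have hΔQ : 0 < Q.1.disc := by rw [← Q.smul_lift, smul_disc]; exact hΔ
  have hAQ : Q.1.a ≠ 0 := by
    rw [← Q.smul_lift]; exact a_ne_zero_of_not_isSquare (not_isSquare_smul_disc hsq _)
  rcases lt_or_gt_of_ne hAQ with hneg | hpos
  · have hQ' : 0 < (negForm Q.1).a := negForm_a_pos.2 hneg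
    have hΔQ' : 0 < (negForm Q.1).disc := by rw [negForm_disc]; exact hΔQ
    rw [geodWeight_of_neg φ hneg hΔQ hQ' hΔQ']
    set c : ℝ := -deckFactor (negForm Q.1) Q.lift⁻¹ with hc
    have hc0 : 0 < c := neg_pos.2 (inv_smul_axisPt₀_of_neg hA hΔ hQ' hΔQ' Q.lift hR one_pos).2
    rw [← integral_Ioi_comp_div_div (fun u => φ (axisPt₀ (negForm Q.1) hQ' hΔQ' u)) hc0]
    refine setIntegral_congr_fun measurableSet_Ioi fun s hs => ?_
    rw [(inv_smul_axisPt₀_of_neg hA hΔ hQ' hΔQ' Q.lift hR hs).1]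
  · rw [geodWeight_of_pos φ hpos hΔQ]
    have hκ0 := (inv_smul_axisPt₀_of_pos hA hΔ hpos hΔQ Q.lift hR one_pos).2
    rw [← integral_Ioi_comp_mul_div (fun u => φ (axisPt₀ Q.1 hpos hΔQ u)) hκ0]
    refine setIntegral_congr_fun measurableSet_Ioi fun s hs => ?_
    rw [(inv_smul_axisPt₀_of_pos hA hΔ hpos hΔQ Q.lift hR hs).1]

include hA hΔ hsq hg₁ hκ hgen hφc hT hsupp in
/-- **Unfolding the closed geodesic** (Tóth's positive-discriminant analogue of DFI (14)).
For `R = [A, B, C]` with `A > 0`, non-square `Δ > 0`, the deck generator `g₁` of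
`stab_q(R) = {±g₁^k}` (`κ₁ = κ(g₁) < 1`), and a continuous kernel `φ` on `ℍ`, invariant under
`z ↦ z + 1` and vanishing below a height `Y > 0`:

  `∫_{κ₁}^{1} P_φ(P_R(t)) dt/t = ∑'_{Q} 𝒲_φ(Q)`,

the integral of the Poincaré series over one period of the closed geodesic of `R` on `Γ₀(q)∖ℍ`
equals the sum of the geodesic weights over the `T`-reduced forms of the `Γ₀(q)`-orbit of `R`.
[cite: Toth2000, main theorem (sums over closed geodesics; cf. Ngo2024 §1)] -/
theorem cycleIntegral_poincareFn_eq_tsum (hY : 0 < Y) :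
    ∫ t in (deckFactor R g₁)..1, poincareFn q φ (axisPt₀ R hA hΔ t) / t =
      ∑' Q : TRedOrbit R q, geodWeight φ Q.1 := by
  classical
  have hg₁s : g₁ ∈ stab R := hg₁.1
  set κ₁ : ℝ := deckFactor R g₁ with hκ₁
  have hκ0 : 0 < κ₁ := deckFactor_pos hA.ne' hΔ.le hg₁s
  set b : ℝ := κ₁⁻¹ with hb
  obtain ⟨𝓕, h𝓕⟩ := exists_finset_adapted_support hA hΔ hsq hg₁ hκ hsupp hY
  -- the kernel along the axis through `ξ_Q⁻¹`
  set F : TRedOrbit R q → ℝ → ℂ := fun Q s => φ (Q.lift⁻¹ • axisPt₀ R hA hΔ s) with hF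
  -- vanishing of `F Q` on the deck interval of an index outside `𝓕`
  have hFzero : ∀ (k : ℤ) (Q : TRedOrbit R q), (k, Q) ∉ 𝓕 →
      ∀ s ∈ Set.Icc (b ^ k * κ₁) (b ^ k), F Q s = 0 := by
    intro k Q hk s hs
    have hbk : 0 < b ^ k := zpow_pos (inv_pos.2 hκ0) k
    -- `s = b^k t` with `t ∈ [κ₁, 1]`
    have ht : s / b ^ k ∈ Set.Icc κ₁ 1 := by
      constructor
      · rw [le_div_iff₀ hbk]; linarith [hs.1]
      · rw [div_le_one hbk]; exact hs.2
    have ht0 : 0 < s / b ^ k := hκ0.trans_le ht.1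
    have := h𝓕 (k, Q) hk (s / b ^ k) ht
    rw [adaptedElt_inv_smul hA hΔ hg₁s (k, Q) ht0] at this
    simp only at this
    rwa [mul_div_cancel₀ _ hbk.ne'] at this
  -- Step 1: the Poincaré series is a finite sum on the period
  have hP : ∀ t ∈ Set.Icc κ₁ 1, poincareFn q φ (axisPt₀ R hA hΔ t) =
      ∑ x ∈ 𝓕, φ ((adaptedElt g₁ x)⁻¹ • axisPt₀ R hA hΔ t) := by
    intro t ht
    rw [poincareFn_eq_tsum_adapted hA hΔ hsq hg₁ hκ hgen hT]
    exact tsum_eq_sum fun x hx => h𝓕 x hx t ht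
  have hκle : κ₁ ≤ 1 := hκ.le
  -- Step 2: integrate termwise
  have hstep2 : ∫ t in κ₁..1, poincareFn q φ (axisPt₀ R hA hΔ t) / t =
      ∑ x ∈ 𝓕, ∫ t in κ₁..1, φ ((adaptedElt g₁ x)⁻¹ • axisPt₀ R hA hΔ t) / t := by
    rw [← intervalIntegral.integral_finsetSum]
    · apply intervalIntegral.integral_congr
      intro t ht
      rw [Set.uIcc_of_le hκle] at ht
      simp only
      rw [hP t ht, Finset.sum_div]
    · intro x _
      exact intervalIntegrable_smul_axis hA hΔ hφc _ hκ0 one_pos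
  -- Step 3: substitute `s = b^k t` in each term
  have hstep3 : ∀ x : ℤ × TRedOrbit R q,
      ∫ t in κ₁..1, φ ((adaptedElt g₁ x)⁻¹ • axisPt₀ R hA hΔ t) / t =
        ∫ s in (b ^ x.1 * κ₁)..(b ^ x.1), F x.2 s / s := by
    intro x
    have hbk : (b ^ x.1 : ℝ) ≠ 0 := (zpow_pos (inv_pos.2 hκ0) x.1).ne'
    have hb' : (deckFactor R g₁)⁻¹ = b := by rw [hb, hκ₁]
    have hbC : ((b ^ x.1 : ℝ) : ℂ) ≠ 0 := by exact_mod_cast hbk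
    have e1 : ∫ t in κ₁..1, φ ((adaptedElt g₁ x)⁻¹ • axisPt₀ R hA hΔ t) / t =
        ∫ t in κ₁..1, ((b ^ x.1 : ℝ) : ℂ) * (F x.2 (b ^ x.1 * t) / (((b ^ x.1 * t : ℝ)) : ℂ)) := by
      apply intervalIntegral.integral_congr
      intro t ht
      rw [Set.uIcc_of_le hκle] at ht
      have ht0 : 0 < t := hκ0.trans_le ht.1
      simp only [hF]
      rw [adaptedElt_inv_smul hA hΔ hg₁s x ht0, hb', Complex.ofReal_mul, ← mul_div_assoc,
        mul_div_mul_left _ _ hbC]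
    rw [e1, intervalIntegral.integral_const_mul,
      intervalIntegral.integral_comp_mul_left (fun s => F x.2 s / (s : ℂ)) hbk, mul_one,
      Complex.real_smul, ← mul_assoc, ← Complex.ofReal_mul, mul_inv_cancel₀ hbk,
      Complex.ofReal_one, one_mul]
  simp_rw [hstep2, hstep3]
  -- Step 4: group by the form `Q`
  rw [← Finset.sum_fiberwise_of_maps_to (g := Prod.snd) (t := 𝓕.image Prod.snd)
    (fun x hx => Finset.mem_image_of_mem _ hx)]
  -- Step 5: each fibre telescopes to the geodesic weight
  have hfibre : ∀ Q : TRedOrbit R q,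
      ∑ x ∈ 𝓕 with x.2 = Q, ∫ s in (b ^ x.1 * κ₁)..(b ^ x.1), F x.2 s / s = geodWeight φ Q.1 := by
    intro Q
    -- reindex the fibre by the exponent
    have hinj : Set.InjOn Prod.fst (↑(𝓕.filter (fun x => x.2 = Q)) : Set (ℤ × TRedOrbit R q)) := by
      intro x hx y hy h
      rw [Finset.coe_filter, Set.mem_setOf_eq] at hx hy
      exact Prod.ext h (hx.2.trans hy.2.symm)
    have e1 : ∑ x ∈ 𝓕 with x.2 = Q, ∫ s in (b ^ x.1 * κ₁)..(b ^ x.1), F x.2 s / s =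
        ∑ k ∈ (𝓕.filter (fun x => x.2 = Q)).image Prod.fst,
          ∫ s in (b ^ k * κ₁)..(b ^ k), F Q s / s := by
      rw [Finset.sum_image hinj]
      refine Finset.sum_congr rfl fun x hx => ?_
      rw [Finset.mem_filter] at hx
      rw [hx.2]
    rw [e1, sum_integral_deck_intervals hκ0 hκ
      (fun a b' ha hb' => intervalIntegrable_smul_axis hA hΔ hφc _ ha hb') _ ?_]
    · exact integral_Ioi_lift_inv_smul_eq_geodWeight hA hΔ hsq Q
    · intro k hk s hs
      apply hFzero k Q _ s hs
      intro hmem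
      exact hk (Finset.mem_image.2 ⟨(k, Q), Finset.mem_filter.2 ⟨hmem, rfl⟩, rfl⟩)
  simp_rw [hfibre]
  -- Step 6: the weights vanish off the image
  symm
  apply tsum_eq_sum
  intro Q hQ
  rw [← hfibre Q]
  apply Finset.sum_eq_zero
  intro x hx
  rw [Finset.mem_filter] at hx
  exact absurd (Finset.mem_image.2 ⟨x, hx.1, hx.2⟩) hQ

end unfold

end RootForms

end Literature.NumberTheory.Sieve
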